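import Literature.Analysis.FluidPDE.NewtonLocalPotential
import Literature.Analysis.FluidPDE.HarmonicBallMeanValue
import Literature.Analysis.FluidPDE.HelmholtzAnnihilator
import HarnessLib

/-!
# Weyl's lemma on a ball, with interior estimates

Analysis/FluidPDE support file (everything proved, no definitions) on the discharge path of the
named fact `Literature.Analysis.FluidPDE.LaplaceDivFormInteriorHolder`
(`NSBoundedSpatialHolder.lean`; Gilbarg–Trudinger 2001, Thm. 8.24 for the Laplacian). After the
divergence-form right-hand side has been absorbed into a Newtonian potential, the weak solution
differs from that potential by a function `H ∈ L¹(B(c, R))` which is **weakly harmonic**,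
`∫_B H Δφ = 0` for all `φ ∈ C_c^∞(B(c, R))`, and one needs a representative of `H` with a sup
bound and a Lipschitz bound on an inner ball, both controlled by `‖H‖_{L¹(B)}` (Weyl's lemma in
quantitative form; Gilbarg–Trudinger, Thm. 2.10 for the interior derivative estimate).

We give a boundary-free, limit-free proof with the radial weight
`λ = λ^{r₁/2, r₁} = Δ((1 - θ)Γ)` of the tree (`newtonFarLaplacian`, `FluidPDE/NewtonKernel`:
smooth, supported in `r₁/2 ≤ |z| ≤ r₁`) and its two companions from `FluidPDE/NewtonLocalPotential`,
the truncated potential `N[φ] = Γ₀ ⋆ φ` and the smoothing `Λ[φ] = λ ⋆ φ`, linked by Green's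
representation at scale `r₁`: `ΔN[φ] = φ - Λ[φ]` (`laplacian_newtonNearPotential`). The
representative is the smoothing of the zero extension, `H' = Λ[1_B H]`:

* `abs_newtonFarSmoothing_le`, `abs_newtonFarSmoothing_sub_le`: `|Λ[G](x)| ≤ (sup|λ|) ‖G‖₁` and
  `|Λ[G](x) - Λ[G](z)| ≤ (sup‖Dλ‖) ‖G‖₁ |x - z|` for `G ∈ L¹(ℝ³)` (differentiation of the
  convolution, `fderiv_convolution_lsmul_apply`, and the mean value inequality);
* `integral_mul_newtonFarSmoothing`: `∫ φ Λ[G] = ∫ G Λ[φ]` (Fubini; `λ` is even);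
* `ae_eq_newtonFarSmoothing_indicator`: **if `H` is weakly harmonic on `B(c, R)` then
  `H = Λ[1_B H]` a.e. on `B(c, R - r₁)`**: for `φ ∈ C_c^∞(B(c, R - r₁))`,
  `∫ φ Λ[1_B H] = ∫_B H Λ[φ] = ∫_B H φ - ∫_B H ΔN[φ] = ∫_B H φ`, because `N[φ]` is a test
  function on `B(c, R)` (its support is that of `φ` thickened by `r₁`); conclude with the
  fundamental lemma of the calculus of variations
  (`IsOpen.ae_eq_zero_of_integral_contDiff_smul_eq_zero`);
* `exists_lipschitz_rep_of_weaklyHarmonic` — the packaged statement: for every `r₁ > 0` there is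
  `K = K(r₁)` such that every `H ∈ L¹(B(c, R))` weakly harmonic on `B(c, R)` agrees a.e. on
  `B(c, R - r₁)` with an `H'` satisfying `|H'| ≤ K‖H‖_{L¹(B)}` and
  `|H'(x) - H'(z)| ≤ K‖H‖_{L¹(B)}|x - z|` on all of `ℝ³`.

## Mathlib / tree search

Mathlib has harmonic functions (`InnerProductSpace.HarmonicOnNhd`) but no Weyl lemma and no mean
value property on `ℝⁿ` (`lean search 'weyl|weakly harmonic|HarmonicOn.*ae'`: nothing); the
tree's Weyl-type results are whole-space Liouville theorems (`DivCurlLiouvilleBounded`,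
`HelmholtzAnnihilator`, `TsaiSelfSimilarPressureProofs` §3), by mollifier sequences and Lebesgue
differentiation. Tree (all used): `newtonFarLaplacian` with `contDiff_`/`continuous_`/
`hasCompactSupport_`/`tsupport_newtonFarLaplacian_subset`, `newtonFarLaplacian_eq_profile`
(`NewtonKernel`, `NewtonPotential`); `newtonFarSmoothing`, `newtonNearPotential`,
`newtonFarSmoothing_eq_integral_kernel`, `newtonFarSmoothing_eq_convolution`,
`laplacian_newtonNearPotential`, `contDiff_newtonNearPotential_top`,
`hasCompactSupport_newtonNearPotential`, `newtonNearPotential_eq_zero_of_forall`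
(`NewtonLocalPotential`); `exists_bound_fderiv_newtonFarLaplacian` (`HarmonicBallMeanValue`);
`fderiv_convolution_lsmul_apply` (`HelmholtzAnnihilator`). Mathlib:
`HasCompactSupport.contDiff_convolution_left`, `Convex.norm_image_sub_le_of_norm_fderiv_le`,
`integral_integral_swap`, `Integrable.mul_prod`, `exists_lt_subset_ball`.

## References

* H. Weyl, *The method of orthogonal projection in potential theory*, Duke Math. J. 7 (1940),
  411–444, Lemma 2 (weakly harmonic `⇒` harmonic).
* D. Gilbarg, N. S. Trudinger, *Elliptic Partial Differential Equations of Second Order*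
  (2001), Thm. 2.1 (mean value), (2.16)–(2.17) (Green's representation), Thm. 2.10 (interior
  derivative estimates). [`GilbargTrudinger2001`]
-/

noncomputable section

open MeasureTheory Set Function Filter Topology TopologicalSpace Metric InnerProductSpace
  ContinuousLinearMap
open scoped ENNReal NNReal Convolution ContDiff Laplacian

namespace Literature.Analysis.FluidPDE

namespace WeylLemmaBall

variable {r₀ r₁ : ℝ}

/-! ### The weight `λ`: evenness and bounds -/

/-- `λ` is even (it is a radial function, `newtonFarLaplacian_eq_profile`). [folklore] -/
theorem newtonFarLaplacian_neg (h₀ : 0 < r₀) (h₁ : r₀ < r₁) (z : (EuclideanSpace ℝ (Fin 3))) :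
    newtonFarLaplacian r₀ r₁ (-z) = newtonFarLaplacian r₀ r₁ z := by
  rw [newtonFarLaplacian_eq_profile h₀ h₁, newtonFarLaplacian_eq_profile h₀ h₁, norm_neg]

/-- A uniform bound for the weight `λ` (continuous with compact support). [folklore] -/
theorem exists_bound_newtonFarLaplacian (h₀ : 0 < r₀) (h₁ : r₀ < r₁) :
    ∃ M : ℝ, 0 ≤ M ∧ ∀ z : (EuclideanSpace ℝ (Fin 3)), |newtonFarLaplacian r₀ r₁ z| ≤ M := by
  obtain ⟨M, hM⟩ := (continuous_newtonFarLaplacian h₀ h₁).bounded_above_of_compact_support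
    (hasCompactSupport_newtonFarLaplacian h₀.le h₁)
  refine ⟨max M 0, le_max_right _ _, fun z => ?_⟩
  have h := hM z
  rw [Real.norm_eq_abs] at h
  exact h.trans (le_max_left _ _)

/-! ### The smoothing `Λ[G] = λ ⋆ G` of an integrable function -/

/-- **Sup bound**: `|Λ[G](x)| ≤ (sup |λ|) ∫ |G|` for `G ∈ L¹`. [folklore] -/
theorem abs_newtonFarSmoothing_le {G : (EuclideanSpace ℝ (Fin 3)) → ℝ} (hG : Integrable G) {M : ℝ}
    (hM : ∀ z : (EuclideanSpace ℝ (Fin 3)), |newtonFarLaplacian r₀ r₁ z| ≤ M) (x : (EuclideanSpace ℝ (Fin 3))) :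
    |newtonFarSmoothing r₀ r₁ G x| ≤ M * ∫ y, |G y| := by
  have hM0 : 0 ≤ M := (abs_nonneg _).trans (hM 0)
  rw [newtonFarSmoothing_eq_integral_kernel]
  calc |∫ y, G y * newtonFarLaplacian r₀ r₁ (x - y)|
      ≤ ∫ y, |G y * newtonFarLaplacian r₀ r₁ (x - y)| := abs_integral_le_integral_abs
    _ ≤ ∫ y, M * |G y| := by
        refine integral_mono_of_nonneg (Eventually.of_forall fun y => abs_nonneg _)
          (hG.abs.const_mul M) (Eventually.of_forall fun y => ?_)
        show |G y * newtonFarLaplacian r₀ r₁ (x - y)| ≤ M * |G y|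
        rw [abs_mul, mul_comm]
        exact mul_le_mul_of_nonneg_right (hM _) (abs_nonneg _)
    _ = M * ∫ y, |G y| := integral_const_mul _ _

/-- `Λ[G]` is `C¹` for `G ∈ L¹` (`λ` is smooth with compact support). [folklore] -/
theorem contDiff_one_newtonFarSmoothing (h₀ : 0 < r₀) (h₁ : r₀ < r₁) {G : (EuclideanSpace ℝ (Fin 3)) → ℝ}
    (hG : Integrable G) : ContDiff ℝ 1 (newtonFarSmoothing r₀ r₁ G) := by
  rw [newtonFarSmoothing_eq_convolution]
  exact (hasCompactSupport_newtonFarLaplacian h₀.le h₁).contDiff_convolution_left _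
    (contDiff_newtonFarLaplacian h₀ h₁) hG.locallyIntegrable

/-- `Λ[G]` is continuous for `G ∈ L¹`. [folklore] -/
theorem continuous_newtonFarSmoothing' (h₀ : 0 < r₀) (h₁ : r₀ < r₁) {G : (EuclideanSpace ℝ (Fin 3)) → ℝ}
    (hG : Integrable G) : Continuous (newtonFarSmoothing r₀ r₁ G) :=
  (contDiff_one_newtonFarSmoothing h₀ h₁ hG).continuous

/-- **Gradient bound**: `|DΛ[G](x) v| ≤ (sup ‖Dλ‖) ‖v‖ ∫ |G|` for `G ∈ L¹` (the derivative falls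
on the kernel, `fderiv_convolution_lsmul_apply`). [folklore] -/
theorem abs_fderiv_newtonFarSmoothing_apply_le (h₀ : 0 < r₀) (h₁ : r₀ < r₁) {G : (EuclideanSpace ℝ (Fin 3)) → ℝ}
    (hG : Integrable G) {M : ℝ} (hM : ∀ z : (EuclideanSpace ℝ (Fin 3)), ‖fderiv ℝ (newtonFarLaplacian r₀ r₁) z‖ ≤ M)
    (x v : (EuclideanSpace ℝ (Fin 3))) :
    |fderiv ℝ (newtonFarSmoothing r₀ r₁ G) x v| ≤ M * ‖v‖ * ∫ y, |G y| := by
  have hM0 : 0 ≤ M := (norm_nonneg _).trans (hM 0)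
  rw [newtonFarSmoothing_eq_convolution, fderiv_convolution_lsmul_apply
    (contDiff_newtonFarLaplacian h₀ h₁) (hasCompactSupport_newtonFarLaplacian h₀.le h₁)
    hG.locallyIntegrable x v, convolution_lsmul]
  simp only [smul_eq_mul]
  have hpt : ∀ t : (EuclideanSpace ℝ (Fin 3)), |fderiv ℝ (newtonFarLaplacian r₀ r₁) t v * G (x - t)| ≤
      M * ‖v‖ * |G (x - t)| := by
    intro t
    rw [abs_mul]
    refine mul_le_mul_of_nonneg_right ?_ (abs_nonneg _)
    rw [← Real.norm_eq_abs]
    exact (le_opNorm _ _).trans (mul_le_mul_of_nonneg_right (hM t) (norm_nonneg _))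
  have hGi : Integrable fun t : (EuclideanSpace ℝ (Fin 3)) => |G (x - t)| := (hG.comp_sub_left x).abs
  calc |∫ t, fderiv ℝ (newtonFarLaplacian r₀ r₁) t v * G (x - t)|
      ≤ ∫ t, |fderiv ℝ (newtonFarLaplacian r₀ r₁) t v * G (x - t)| :=
        abs_integral_le_integral_abs
    _ ≤ ∫ t, M * ‖v‖ * |G (x - t)| :=
        integral_mono_of_nonneg (Eventually.of_forall fun t => abs_nonneg _)
          (hGi.const_mul _) (Eventually.of_forall hpt)
    _ = M * ‖v‖ * ∫ y, |G y| := by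
        rw [integral_const_mul]
        congr 1
        exact integral_sub_left_eq_self (fun t => |G t|) volume x

/-- **Lipschitz bound**: `|Λ[G](x) - Λ[G](z)| ≤ (sup ‖Dλ‖) (∫ |G|) |x - z|` for `G ∈ L¹`
(mean value inequality on `ℝ³`). [folklore] -/
theorem abs_newtonFarSmoothing_sub_le (h₀ : 0 < r₀) (h₁ : r₀ < r₁) {G : (EuclideanSpace ℝ (Fin 3)) → ℝ}
    (hG : Integrable G) {M : ℝ} (hM : ∀ z : (EuclideanSpace ℝ (Fin 3)), ‖fderiv ℝ (newtonFarLaplacian r₀ r₁) z‖ ≤ M)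
    (x z : (EuclideanSpace ℝ (Fin 3))) :
    |newtonFarSmoothing r₀ r₁ G x - newtonFarSmoothing r₀ r₁ G z| ≤
      M * (∫ y, |G y|) * ‖x - z‖ := by
  have hM0 : 0 ≤ M := (norm_nonneg _).trans (hM 0)
  have hd : ∀ y ∈ (univ : Set (EuclideanSpace ℝ (Fin 3))), DifferentiableAt ℝ (newtonFarSmoothing r₀ r₁ G) y :=
    fun y _ => (contDiff_one_newtonFarSmoothing h₀ h₁ hG).differentiable one_ne_zero y
  have hb : ∀ y ∈ (univ : Set (EuclideanSpace ℝ (Fin 3))), ‖fderiv ℝ (newtonFarSmoothing r₀ r₁ G) y‖ ≤ M * ∫ y, |G y| := by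
    intro y _
    refine opNorm_le_bound _ (by positivity) fun v => ?_
    rw [Real.norm_eq_abs]
    calc |fderiv ℝ (newtonFarSmoothing r₀ r₁ G) y v| ≤ M * ‖v‖ * ∫ y, |G y| :=
          abs_fderiv_newtonFarSmoothing_apply_le h₀ h₁ hG hM y v
      _ = M * (∫ y, |G y|) * ‖v‖ := by ring
  have h := convex_univ.norm_image_sub_le_of_norm_fderiv_le hd hb (mem_univ z) (mem_univ x)
  rw [Real.norm_eq_abs] at h
  exact h

/-! ### Testing the smoothing against a test function -/

/-- **`∫ φ Λ[G] = ∫ G Λ[φ]`** for `G ∈ L¹` and a continuous compactly supported `φ` (Fubini; the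
weight `λ` is even). [folklore] -/
theorem integral_mul_newtonFarSmoothing (h₀ : 0 < r₀) (h₁ : r₀ < r₁) {G : (EuclideanSpace ℝ (Fin 3)) → ℝ}
    (hG : Integrable G) {φ : (EuclideanSpace ℝ (Fin 3)) → ℝ} (hφ : Continuous φ) (hφc : HasCompactSupport φ) :
    ∫ x, φ x * newtonFarSmoothing r₀ r₁ G x = ∫ y, G y * newtonFarSmoothing r₀ r₁ φ y := by
  obtain ⟨M, hM0, hM⟩ := exists_bound_newtonFarLaplacian h₀ h₁
  set lam := newtonFarLaplacian r₀ r₁ with hlam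
  have hlc : Continuous lam := continuous_newtonFarLaplacian h₀ h₁
  have hφi : Integrable φ := hφ.integrable_of_hasCompactSupport hφc
  -- the integrand on the product space and its integrability
  set Φ : (EuclideanSpace ℝ (Fin 3)) → (EuclideanSpace ℝ (Fin 3)) → ℝ := fun x y => φ x * (G y * lam (x - y)) with hΦ
  have hΦm : AEStronglyMeasurable (uncurry Φ) (volume.prod volume) := by
    refine ((hφ.comp continuous_fst).aestronglyMeasurable).mul
      ((hG.aestronglyMeasurable.comp_snd).mul ?_)
    exact (hlc.comp (continuous_fst.sub continuous_snd)).aestronglyMeasurable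
  have hΦi : Integrable (uncurry Φ) (volume.prod volume) := by
    refine Integrable.mono' (hφi.abs.mul_prod (hG.abs.const_mul M)) hΦm
      (Eventually.of_forall fun p => ?_)
    rcases p with ⟨x, y⟩
    simp only [uncurry_apply_pair, hΦ, norm_mul, Real.norm_eq_abs]
    calc |φ x| * (|G y| * |lam (x - y)|) ≤ |φ x| * (|G y| * M) := by
          gcongr
          exact hM _
      _ = |φ x| * (M * |G y|) := by ring
  -- Fubini
  have hL : ∫ x, φ x * newtonFarSmoothing r₀ r₁ G x = ∫ x, ∫ y, Φ x y := by
    refine integral_congr_ae (Eventually.of_forall fun x => ?_)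
    simp only [hΦ]
    rw [newtonFarSmoothing_eq_integral_kernel, ← integral_const_mul]
  have hR : ∫ y, G y * newtonFarSmoothing r₀ r₁ φ y = ∫ y, ∫ x, Φ x y := by
    refine integral_congr_ae (Eventually.of_forall fun y => ?_)
    simp only [hΦ]
    rw [newtonFarSmoothing_eq_integral_kernel, ← integral_const_mul]
    refine integral_congr_ae (Eventually.of_forall fun x => ?_)
    simp only
    rw [show y - x = -(x - y) by abel, hlam, newtonFarLaplacian_neg h₀ h₁]
    ring
  rw [hL, hR]
  exact integral_integral_swap hΦi

/-- The truncated potential `N[φ]` of a test function on `B(c, ρ')` is a test function on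
`B(c, R)` as soon as `ρ' + r₁ ≤ R` (its support is that of `φ` thickened by `r₁`). [folklore] -/
theorem isTestFunctionOn_newtonNearPotential (h₀ : 0 ≤ r₀) (h₁ : r₀ < r₁) {c : (EuclideanSpace ℝ (Fin 3))} {ρ' R : ℝ}
    (hR : ρ' + r₁ ≤ R) {φ : (EuclideanSpace ℝ (Fin 3)) → ℝ}
    (hφ : FunctionSpaces.IsTestFunctionOn (⟨ball c ρ', isOpen_ball⟩ : Opens (EuclideanSpace ℝ (Fin 3))) φ) :
    FunctionSpaces.IsTestFunctionOn (⟨ball c R, isOpen_ball⟩ : Opens (EuclideanSpace ℝ (Fin 3)))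
      (newtonNearPotential r₀ r₁ φ) := by
  obtain ⟨ρ, hρ, hsub⟩ := exists_lt_subset_ball (isClosed_tsupport φ) hφ.tsupport_subset
  refine ⟨contDiff_newtonNearPotential_top h₀ h₁ hφ.contDiff,
    hasCompactSupport_newtonNearPotential h₀ h₁ hφ.hasCompactSupport, ?_⟩
  -- the support of `N[φ]` lies in the closed ball of radius `ρ + r₁ < R`
  have hsupp : support (newtonNearPotential r₀ r₁ φ) ⊆ closedBall c (ρ + r₁) := by
    intro x hx
    rw [mem_support] at hx
    by_contra hxc
    refine hx (newtonNearPotential_eq_zero_of_forall h₀ h₁ fun z hz => ?_)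
    by_contra hne
    have h1 : x - z ∈ ball c ρ := hsub (subset_tsupport _ (mem_support.2 hne))
    rw [mem_ball] at h1
    rw [mem_closedBall, not_le] at hxc
    have h2 : dist x c ≤ ‖z‖ + dist (x - z) c := by
      calc dist x c ≤ dist x (x - z) + dist (x - z) c := dist_triangle _ _ _
        _ = ‖z‖ + dist (x - z) c := by rw [dist_eq_norm, sub_sub_cancel]
    linarith
  change tsupport (newtonNearPotential r₀ r₁ φ) ⊆ ball c R
  refine (closure_minimal hsupp isClosed_closedBall).trans ?_
  exact closedBall_subset_ball (by linarith)

/-- **Weyl's lemma on a ball, representative form.** If `H ∈ L¹(B(c, R))` is weakly harmonic on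
`B(c, R)` — `∫_B H Δφ = 0` for all `φ ∈ C_c^∞(B(c, R))` — then `H` agrees a.e. on `B(c, R - r₁)`
with the smooth function `Λ[1_B H] = λ^{r₀,r₁} ⋆ (1_B H)`: testing against
`φ ∈ C_c^∞(B(c, R - r₁))`, `∫ φ Λ[1_B H] = ∫_B H Λ[φ] = ∫_B H φ - ∫_B H ΔN[φ] = ∫_B H φ` by Green's
representation `ΔN[φ] = φ - Λ[φ]` and weak harmonicity (`N[φ] ∈ C_c^∞(B(c, R))`), and the
fundamental lemma of the calculus of variations concludes (Weyl 1940, Lemma 2, for the Laplacian;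
this proof avoids mollifier limits). [folklore] -/
theorem ae_eq_newtonFarSmoothing_indicator (h₀ : 0 < r₀) (h₁ : r₀ < r₁) {c : (EuclideanSpace ℝ (Fin 3))} {R : ℝ}
    {H : (EuclideanSpace ℝ (Fin 3)) → ℝ} (hH : IntegrableOn H (ball c R) volume)
    (hharm : ∀ φ : (EuclideanSpace ℝ (Fin 3)) → ℝ,
      FunctionSpaces.IsTestFunctionOn (⟨ball c R, isOpen_ball⟩ : Opens (EuclideanSpace ℝ (Fin 3))) φ →
        ∫ x in ball c R, H x * (Δ φ) x = 0) :
    H =ᵐ[volume.restrict (ball c (R - r₁))]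
      newtonFarSmoothing r₀ r₁ ((ball c R).indicator H) := by
  set G : (EuclideanSpace ℝ (Fin 3)) → ℝ := (ball c R).indicator H with hGdef
  have hG : Integrable G := hH.integrable_indicator measurableSet_ball
  set S := newtonFarSmoothing r₀ r₁ G with hS
  have hSc : Continuous S := continuous_newtonFarSmoothing' h₀ h₁ hG
  set U : Set (EuclideanSpace ℝ (Fin 3)) := ball c (R - r₁) with hU
  -- the difference `S - G` is annihilated by every test function on `U`
  have hLI : LocallyIntegrableOn (fun x => S x - G x) U volume :=
    (hSc.locallyIntegrable.sub hG.locallyIntegrable).locallyIntegrableOn U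
  have hkey : ∀ φ : (EuclideanSpace ℝ (Fin 3)) → ℝ, ContDiff ℝ ∞ φ → HasCompactSupport φ → tsupport φ ⊆ U →
      ∫ x, φ x • (S x - G x) = 0 := by
    intro φ hφ hφc hφU
    have hφT : FunctionSpaces.IsTestFunctionOn (⟨ball c (R - r₁), isOpen_ball⟩ : Opens (EuclideanSpace ℝ (Fin 3))) φ :=
      ⟨hφ, hφc, hφU⟩
    have hφ2 : ContDiff ℝ 2 φ := hφ.of_le (by norm_cast)
    have hφcont : Continuous φ := hφ.continuous
    obtain ⟨Cφ, hCφ⟩ := hφcont.bounded_above_of_compact_support hφc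
    -- `N[φ]` is a test function on `B(c, R)`, so `∫_B H ΔN[φ] = 0`
    have hN : FunctionSpaces.IsTestFunctionOn (⟨ball c R, isOpen_ball⟩ : Opens (EuclideanSpace ℝ (Fin 3)))
        (newtonNearPotential r₀ r₁ φ) :=
      isTestFunctionOn_newtonNearPotential h₀.le h₁ (by linarith) hφT
    have hΔN : Continuous (Δ (newtonNearPotential r₀ r₁ φ)) :=
      continuous_laplacian (hN.contDiff.of_le (by norm_cast))
    have hΔNc : HasCompactSupport (Δ (newtonNearPotential r₀ r₁ φ)) :=
      hN.hasCompactSupport.mono' fun x hx => by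
        by_contra h
        exact hx (laplacian_eq_zero_of_notMem_tsupport h)
    obtain ⟨CΔ, hCΔ⟩ := hΔN.bounded_above_of_compact_support hΔNc
    have hzero : ∫ y, G y * (Δ (newtonNearPotential r₀ r₁ φ)) y = 0 := by
      have h := hharm _ hN
      rw [← integral_indicator measurableSet_ball] at h
      rw [← h]
      refine integral_congr_ae (Eventually.of_forall fun y => ?_)
      simp only [hGdef]
      exact (indicator_mul_left _ _ _).symm
    -- integrability of the pieces
    have hI1 : Integrable fun x => φ x * S x :=
      (hφcont.mul hSc).integrable_of_hasCompactSupport hφc.mul_right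
    have hI2 : Integrable fun x => φ x * G x :=
      hG.bdd_mul hφcont.aestronglyMeasurable (Eventually.of_forall hCφ)
    have hI3 : Integrable fun y => G y * φ y :=
      hG.mul_bdd hφcont.aestronglyMeasurable (Eventually.of_forall hCφ)
    have hI4 : Integrable fun y => G y * (Δ (newtonNearPotential r₀ r₁ φ)) y :=
      hG.mul_bdd hΔN.aestronglyMeasurable (Eventually.of_forall hCΔ)
    -- the computation
    have h1 : ∫ x, φ x * S x = ∫ y, G y * φ y := by
      rw [hS, integral_mul_newtonFarSmoothing h₀ h₁ hG hφcont hφc]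
      have hΛ : ∀ y, newtonFarSmoothing r₀ r₁ φ y =
          φ y - (Δ (newtonNearPotential r₀ r₁ φ)) y := fun y => by
        rw [laplacian_newtonNearPotential h₀ h₁ hφ2 y]; ring
      simp_rw [hΛ, mul_sub]
      rw [integral_sub hI3 hI4, hzero, sub_zero]
    simp_rw [smul_eq_mul, mul_sub]
    rw [integral_sub hI1 hI2, h1, sub_eq_zero]
    exact integral_congr_ae (Eventually.of_forall fun x => mul_comm _ _)
  have hae := isOpen_ball.ae_eq_zero_of_integral_contDiff_smul_eq_zero hLI hkey
  -- translate to the restricted measure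
  rw [EventuallyEq, ae_restrict_iff' measurableSet_ball]
  filter_upwards [hae] with x hx hxU
  have hxB : x ∈ ball c R := ball_subset_ball (by linarith) hxU
  have hGx : G x = H x := by rw [hGdef, indicator_of_mem hxB]
  have := hx hxU
  rw [← hGx]
  linarith

/-- **Weyl's lemma on a ball with interior estimates.** For every `r₁ > 0` there is a constant
`K = K(r₁)` with the following property: if `H ∈ L¹(B(c, R))` is weakly harmonic on `B(c, R)`
(`∫_B H Δφ = 0` for all `φ ∈ C_c^∞(B(c, R))`), then `H` agrees a.e. on `B(c, R - r₁)` with a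
function `H'` such that `|H'(x)| ≤ K ∫_B |H|` and `|H'(x) - H'(z)| ≤ K (∫_B |H|) |x - z|` for all
`x, z ∈ ℝ³` — namely `H' = λ^{r₁/2, r₁} ⋆ (1_B H)`, with `K = max (sup|λ|, sup‖Dλ‖)` (Weyl 1940,
Lemma 2; Gilbarg–Trudinger 2001, Thm. 2.10 for the form of the interior estimate). [folklore] -/
theorem exists_lipschitz_rep_of_weaklyHarmonic {r₁ : ℝ} (h₁ : 0 < r₁) :
    ∃ K : ℝ, 0 ≤ K ∧ ∀ (c : (EuclideanSpace ℝ (Fin 3))) (R : ℝ) (H : (EuclideanSpace ℝ (Fin 3)) → ℝ), IntegrableOn H (ball c R) volume →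
      (∀ φ : (EuclideanSpace ℝ (Fin 3)) → ℝ,
        FunctionSpaces.IsTestFunctionOn (⟨ball c R, isOpen_ball⟩ : Opens (EuclideanSpace ℝ (Fin 3))) φ →
          ∫ x in ball c R, H x * (Δ φ) x = 0) →
      ∃ H' : (EuclideanSpace ℝ (Fin 3)) → ℝ, H =ᵐ[volume.restrict (ball c (R - r₁))] H' ∧
        (∀ x, |H' x| ≤ K * ∫ y in ball c R, |H y|) ∧
        ∀ x z, |H' x - H' z| ≤ K * (∫ y in ball c R, |H y|) * ‖x - z‖ := by
  have h₀ : 0 < r₁ / 2 := by positivity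
  have h₀₁ : r₁ / 2 < r₁ := by linarith
  obtain ⟨M₀, hM₀0, hM₀⟩ := exists_bound_newtonFarLaplacian h₀ h₀₁
  obtain ⟨M₁, hM₁0, hM₁⟩ := exists_bound_fderiv_newtonFarLaplacian h₀ h₀₁
  refine ⟨max M₀ M₁, le_max_of_le_left hM₀0, fun c R H hH hharm => ?_⟩
  set G : (EuclideanSpace ℝ (Fin 3)) → ℝ := (ball c R).indicator H with hGdef
  have hG : Integrable G := hH.integrable_indicator measurableSet_ball
  have hGH : ∫ y, |G y| = ∫ y in ball c R, |H y| := by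
    rw [← integral_indicator measurableSet_ball]
    refine integral_congr_ae (Eventually.of_forall fun y => ?_)
    simp only [hGdef, ← Real.norm_eq_abs, norm_indicator_eq_indicator_norm]
  have hI0 : 0 ≤ ∫ y in ball c R, |H y| := integral_nonneg fun y => abs_nonneg _
  refine ⟨newtonFarSmoothing (r₁ / 2) r₁ G, ae_eq_newtonFarSmoothing_indicator h₀ h₀₁ hH hharm,
    fun x => ?_, fun x z => ?_⟩
  · calc |newtonFarSmoothing (r₁ / 2) r₁ G x| ≤ M₀ * ∫ y, |G y| :=
          abs_newtonFarSmoothing_le hG hM₀ x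
      _ ≤ max M₀ M₁ * ∫ y in ball c R, |H y| := by
          rw [hGH]
          exact mul_le_mul_of_nonneg_right (le_max_left _ _) hI0
  · calc |newtonFarSmoothing (r₁ / 2) r₁ G x - newtonFarSmoothing (r₁ / 2) r₁ G z|
          ≤ M₁ * (∫ y, |G y|) * ‖x - z‖ := abs_newtonFarSmoothing_sub_le h₀ h₀₁ hG hM₁ x z
      _ ≤ max M₀ M₁ * (∫ y in ball c R, |H y|) * ‖x - z‖ := by
          rw [hGH]
          gcongr
          exact le_max_right _ _

end WeylLemmaBall

end Literature.Analysis.FluidPDE
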